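import Summits.BirchSwinnertonDyer.Rank1Residual.Additive.KatoDescentRealizableContraOfFacts
import Summits.BirchSwinnertonDyer.BirchSwinnertonDyer.Theorems.KatoDescentPotSupersingularTowerTorsionFiniteImai
import HarnessLib

set_option autoImplicit false

/-!
# Stub 4 `stub_realizableOfKMCFine` of the Kato–Perrin-Riou skeletons v4 from EXACTLY {`Kato2004.thm12_4`, H2X}: the
# Imai schema of `KatoDescentRealizableContraOfFacts` §3 DISCHARGED by the tree theorem (seat `bsd-cm-prr-ty1` g13, cell
# `bsd-cm`; theorems only: no definition, no named fact, no instance, no `sorry`)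

Cruxes stmt-BirchSwinnertonDyer-19945 (`kato_perrin_riou_zp`) / -19223 (`kato_perrin_riou_istar`), stub 4
`TorsionFree.RealizableOfKMC IsKatoZetaDescentDatumOfContra KatoMainConjectureFineContra`.  g6's reduction
`ContraRealizable.realizableOfKMC_contra_of_thm12_4_of_h2Embedding_of_localFinite` (p632384) left the residual
{`Kato2004.thm12_4`, `Kato2004.exists_iwasawaH2Data_fineSelmerDual_embedding` (H2X), the displayed IMAI SCHEMA
«`0 ≤ v_p(j(W))`, `κ` cyclotomic, `v` the place at `p` ⟹ `W(ℚ_{p,∞})[p^∞] = (W(ℚ̄)[p^∞])^{ker κ ⊓ D_v}` finite»}.  The schema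
is now a TREE THEOREM at every prime: `TowerTorsionFiniteOrdinary.finite_fixedPoints_kerSubgroup_inf_decomp` (cell bsd-potss,
p686208, `Theorems/KatoDescentPotSupersingularTowerTorsionFiniteImai.lean`: Serre 1967 §5 Prop. 8 on the potentially
supersingular rows, the good-ordinary reduction map with Frobenius equivariance + Weil-pairing annihilators on the potentially
ordinary ones, `p = 2` included; its `_holds` form proves the Literature named fact
`imai1975_finite_fixedPoints_kerSubgroup_inf_decomp_of_padicValRat_j_nonneg` VERBATIM).  THIS FILE substitutes it:
* `exists_isKatoZetaDescentDatumOfContra_of_kmcFineContra_of_padicValRat_j_nonneg` — per pair `(W, p)`, `p ≠ 2`,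
  `0 ≤ v_p(j(W))`: {`thm12_4`, H2X} + `KatoMainConjectureFineContra W p` ⟹ a realised contragredient Kato descent datum
  (g6 §2 with `hloc` discharged);
* **`realizableOfKMC_contra_of_thm12_4_of_h2Embedding`** — STUB 4 BY NAME from the two named facts alone:
  `Kato2004.thm12_4 → Kato2004.exists_iwasawaH2Data_fineSelmerDual_embedding →
  TorsionFree.RealizableOfKMC IsKatoZetaDescentDatumOfContra KatoMainConjectureFineContra`.
RESIDUAL OF STUB 4 AFTER THIS FILE = {`Kato2004.thm12_4`, H2X} — two CONSTRUCTION facts about Kato's `𝐇¹_Γ(T_pW)` /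
`𝐇²_Γ(T_pW)` (Thm. 12.4; (14.9.1) + (14.14.1)), both named facts of the tree, neither proved here.
HONEST LABEL: theorems only; no stub or item is closed (the skeleton stub is closed only when a prover row files it);
nothing is asserted on 19945 / 19223; Kato's Main Conjecture is the HYPOTHESIS `KMC` of the reading, not touched; BSD is not
proved for any curve.  References: [Kato2004Asterisque] Thm. 12.4 (p. 221), Thm. 12.5 (1) (pp. 221–222), Conj. 12.10 (p. 224),
(14.9.1) (p. 239), §14.14 (14.14.1) (p. 243); [Imai1975] Theorem (p. 12); [Serre1967GroupesPDivisibles] §5 Prop. 8;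
[RohrlichInventiones1984] Theorem (p. 409).
-/

noncomputable section

open scoped Classical NumberField

open WeierstrassCurve Field IsDedekindDomain NumberField Literature.NumberTheory.EllipticCurves
  Literature.NumberTheory.EllipticCurves.Kato2004 Literature.NumberTheory.GaloisRepresentations
  Literature.NumberTheory.EllipticCurves.IwasawaAlgebra Literature.NumberTheory.EllipticCurves.Rank1Residual
open Summit.BirchSwinnertonDyer.Rank1Residual Summit.BirchSwinnertonDyer.Rank1Residual.Additive
  Summit.BirchSwinnertonDyer.BirchSwinnertonDyer.Theorems.TowerTorsionFiniteOrdinary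

namespace Summit.BirchSwinnertonDyer.Rank1Residual.Additive.ContraRealizable

/-- **Per pair `(W, p)`, `p ≠ 2`, `0 ≤ v_p(j(W))`: a realised contragredient Kato descent datum from {`thm12_4`, H2X} and
`KatoMainConjectureFineContra W p`** — g6's `exists_isKatoZetaDescentDatumOfContra_of_kmcFineContra` with its local-finiteness
hypothesis `hloc` DISCHARGED by `finite_fixedPoints_kerSubgroup_inf_decomp` (Imai 1975, tree theorem p686208).  CONDITIONAL on
the two named facts and on `KMC`; nothing asserted about 12.10 or BSD.
[cite: Kato2004Asterisque, Thm. 12.4 (p. 221), Thm. 12.5 (1) (pp. 221–222), Conj. 12.10 (p. 224), (14.9.1) (p. 239), §14.14 (14.14.1) (p. 243)]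
[cite: Imai1975, Theorem (p. 12)] [cite: RohrlichInventiones1984, Theorem (p. 409)] -/
theorem exists_isKatoZetaDescentDatumOfContra_of_kmcFineContra_of_padicValRat_j_nonneg (h12 : Kato2004.thm12_4)
    (hH2 : Kato2004.exists_iwasawaH2Data_fineSelmerDual_embedding)
    (W : WeierstrassCurve ℚ) [W.IsElliptic] [W.IsGloballyMinimal] (p : ℕ) [Fact p.Prime] (hp : p ≠ 2)
    (hj : 0 ≤ padicValRat p W.j) (hKMC : KatoMainConjectureFineContra W p) :
    ∃ D : KatoDescentDatum p, IsKatoZetaDescentDatumOfContra W p D :=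
  exists_isKatoZetaDescentDatumOfContra_of_kmcFineContra h12 hH2 W p hp
    (fun κ v hκ hv ↦ finite_fixedPoints_kerSubgroup_inf_decomp W p hj κ hκ v hv) hKMC

/-- **STUB 4 `stub_realizableOfKMCFine` of the Kato–Perrin-Riou skeletons v4 from EXACTLY the two named facts
{`Kato2004.thm12_4`, H2X}** — verbatim the type `TorsionFree.RealizableOfKMC IsKatoZetaDescentDatumOfContra
KatoMainConjectureFineContra`; g6's `realizableOfKMC_contra_of_thm12_4_of_h2Embedding_of_localFinite` with the Imai schema
supplied by the tree theorem `finite_fixedPoints_kerSubgroup_inf_decomp` (its hypothesis `0 ≤ v_p(j)` is a binder of the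
reading).  CONDITIONAL; nothing asserted about 12.10 or BSD. [cite: Kato2004Asterisque, Thm. 12.4 (p. 221), Thm. 12.5 (1)
(pp. 221–222), (14.9.1) (p. 239), §14.14 (14.14.1) (p. 243)] [cite: Imai1975, Theorem (p. 12)] -/
theorem realizableOfKMC_contra_of_thm12_4_of_h2Embedding (h12 : Kato2004.thm12_4)
    (hH2 : Kato2004.exists_iwasawaH2Data_fineSelmerDual_embedding) :
    TorsionFree.RealizableOfKMC IsKatoZetaDescentDatumOfContra KatoMainConjectureFineContra :=
  realizableOfKMC_contra_of_thm12_4_of_h2Embedding_of_localFinite h12 hH2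
    (fun W _ p _ κ v hj hκ hv ↦ finite_fixedPoints_kerSubgroup_inf_decomp W p hj κ hκ v hv)

end Summit.BirchSwinnertonDyer.Rank1Residual.Additive.ContraRealizable

end
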